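import Summits.QuantumFields.BalabanUV.T4Continuum.Support.NE3LocalReadouts
import Summits.QuantumFields.BalabanUV.T4Continuum.Support.NE3EnergyAssembly

/-!
# T⁴ programme, node NE3 — readings (D)∕(F), row S6-Z2 (P3 leaf L12 «READ-OUTS»), file 2: THE TWO-LEVEL LOCAL ACTION
# READ-OUT AT A PAIR — `|L^{d−4}·A_{Y}(U_A) − A_{B(Y)}(U_B)| ≤ [β′-loc at U_B] + L^{d−4}·[a_A·Σ‖d_{U_A}X‖ + (7/2)·Σ bondSq X]`

NE3 formalisation swarm `b2b-balaban-t4-ne3-formalise-*` of the cell `pub-balaban`, unit `b2b-balaban-t4-ne3-formalise-leaf-01`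
(gen 2), row **S6-Z2** of `t4/formal/NE3/LEAVES.md` (road P3's leaf L12 of `t4/skeletons/NE3-t4-ne3-p3.md` §2: «(D)
|e_{k+1}(V)(x) − e_k(V)(x)| ≤ |𝓓_{W(B(x))}(U_B)| + |A_{B(x)}(W) − A_{B(x)}(U_A)| ≤ [β′-loc KERNEL `abs_deficit_blockWindow_le` at U_B]
+ [C·(plaquette radius)·Σ_p‖(d_{U_A}X)(p)‖ + C·Σ‖X‖²]»).  File 1 (`NE3LocalReadouts`, p213867) gave the second bracket.
THIS FILE composes the displayed inequality for ONE pair of configurations on ONE finite set `Y` of coarse sites, every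
input BY NAME ([folklore]; 0 defs, 0 sorry):

* `windowAction_sub_eq` — the IDENTITY behind (D): if some site gauge `u` carries the averaged-and-rescaled `U_B` to the
  unit-segment endpoint `U_A·e^{X}` (`gaugeAct u (rescale L (bavg L U_B)) = vary U_A X 1` — the conclusion of road P3's
  leaf L1 REP, here a HYPOTHESIS asserted for nothing), then
  `L^{d−4}·A_Y(U_A) − A_{B(Y)}(U_B) = 𝓓_{W(Y)}(U_B) + L^{d−4}·(A_Y(U_A) − A_Y(U_A e^X))`
  (`T4AveragingDeficitWall.deficit` on the block window, `MinimalActionLevels.fineAction_rescale_bavg`, gauge invariance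
  `NE3EnergyAssembly.fineAction_gaugeAct`);
* **`abs_twoLevel_windowAction_sub_le`** — THE (D) READ-OUT AT A PAIR: β′-loc
  (`T4AveragingDeficitNonAbelian.abs_deficit_blockWindow_le`, KERNEL) for the first term + file 1's
  `abs_fineAction_vary_sub_le` for the second:
  `|L^{d−4}·A_Y(U_A) − A_{B(Y)}(U_B)| ≤ wallConstLoc·(a_B·‖∇F‖_{ℓ¹} + ‖∇F‖²_{ℓ²} + a_B³·#Y)(N_{2L}(B(Y)), U_B)
     + L^{d−4}·(a_A·Σ_{p∈Y×planes}‖(d_{U_A}X)(p)‖ + (7/2)·Σ_{p∈Y×planes} bondSq X p)`;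
* `abs_twoLevel_windowAction_sub_le_of_smallField` — the same with the coarse plaquette radius read from `SmallField U_A a_A`.

With road P3's LOCAL energy rate T-LOC-P3 (the right-hand side is `O(ε²·(L⁻¹)^{k})` per unit cube, volume-free) this is the
`T4EtaRateMin.LocalRate R_D (C_D ε²) (L⁻¹)` face for the plaquette-sum readings — assembled in Z0 `Spine/NE3SegmentRoute`
(NOT a crew row), not here.

HONEST FRAMING.  A read-out inequality about TWO FIXED configurations and a gauge relating them; no minimiser, no rate;
the representation hypothesis is road P3's L1 (B11 Prop. 2 (19)–(21) p. 281 TYPE) and is asserted for nothing here; β′-loc is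
a KERNEL theorem of row NE3-R2's wall audit, imported BY NAME; nothing printed is a hypothesis; no `def`, no `def … : Prop`
fact, no `sorry`; axioms ⊆ {propext, Classical.choice, Quot.sound}; `BetaPertH`, (B), G-an2-4 occur nowhere.  **NE3 is NOT
proved**; `LocalRate` stays CONDITIONAL on T-LOC-P3 = ⟨RelLandauRep, TangentCoercive, AvgRemainderBound, ProjectorLocality⟩.
Finite T⁴ rung (B)+1 — NOT infinite volume, NOT a mass gap, NOT the Clay problem, NOT summit progress; spine PROVED 0∕9.
HONEST DEPENDENCY (cell page 1): continuum YM on T⁴ ⇐ BetaPertH ∧ nine spine estimates (0/9 proved); BetaPertH ⇐ (D1) ∧ (D4) ∧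
CAP+tail; G-an2-4 gates asym, D1 and NE2/3/4.  PLACEMENT (human rule 2026-08-19): under `Summits/QuantumFields/BalabanUV/`.
-/

set_option autoImplicit false

open scoped BigOperators Matrix Matrix.Norms.L2Operator
open NormedSpace

namespace Summit.QuantumFields.BalabanUV.T4Continuum.NE3LocalReadoutsPair

open Literature.MathematicalPhysics.QuantumFieldTheory.Balaban1983to89
open B7Prop1Explicit B7Prop2Explicit MatrixLog UnitaryModel
open T4AveragingDeficitWall hiding Site Plane Plaq Bond
open T4AveragingDeficitWallBoundary (gradFluxL1)
open T4AveragingDeficitNonAbelian (wallConstLoc abs_deficit_blockWindow_le)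
open MinimalActionLevels (fineAction_rescale_bavg)
open NE3EnergyAssembly (fineAction_gaugeAct)
open NE3HessBounds (bondSq)
open NE3LocalReadouts (abs_fineAction_vary_sub_le)
open NE3EnergySource (fhol_sub_one_le_of_smallField)

noncomputable section

variable {d : ℕ} {n : Type*} [Fintype n] [DecidableEq n] [Nonempty n]

/-! ## §1 The identity behind (D) -/

omit [Nonempty n] in
/-- **THE (D) IDENTITY**: if a site gauge `u` carries the rescaled block average of `U_B` to `U_A·e^{X}`, then on every finite
set `Y` of coarse sites
`L^{d−4}·A_Y(U_A) − A_{B(Y)}(U_B) = 𝓓_{W(Y)}(U_B) + L^{d−4}·(A_Y(U_A) − A_Y(U_A e^{X}))`. [folklore] -/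
theorem windowAction_sub_eq (L : ℕ) {UB UA : Site d → Fin d → (Matrix n n ℂ)ˣ}
    {X : Site d → Fin d → Matrix n n ℂ} {u : Site d → (Matrix n n ℂ)ˣ}
    (hrep : gaugeAct u (rescale L (bavg L UB)) = vary UA X 1) (Y : Finset (Site d)) :
    (L : ℝ) ^ ((d : ℤ) - 4) * fineAction UA (Y ×ˢ Finset.univ) - fineAction UB (blockSites L Y ×ˢ Finset.univ)
      = deficit L UB (blockWindow L Y)
        + (L : ℝ) ^ ((d : ℤ) - 4) * (fineAction UA (Y ×ˢ Finset.univ) - fineAction (vary UA X 1) (Y ×ˢ Finset.univ)) := by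
  have hco : coarseAction L UB (Y ×ˢ Finset.univ) = fineAction (vary UA X 1) (Y ×ˢ Finset.univ) := by
    rw [← fineAction_rescale_bavg, ← fineAction_gaugeAct u, hrep]
  simp only [deficit, blockWindow, hco]
  ring

/-! ## §2 THE (D) READ-OUT AT A PAIR -/

/-- **THE TWO-LEVEL LOCAL ACTION READ-OUT** (row S6-Z2, P3 L12 (D), both brackets): for `L ≥ 1`, a `U(N)`-valued fine
configuration `U_B` in `SmallField U_B a_B` with `512(d+1)(d+4)L²a_B ≤ 1`, a `U(N)`-valued coarse configuration `U_A` whose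
plaquette variables on `Y × planes` are within `a_A` of `1`, a skew direction `X` and a site gauge `u` with
`gaugeAct u (rescale L (bavg L U_B)) = vary U_A X 1`:
`|L^{d−4}·A_Y(U_A) − A_{B(Y)}(U_B)| ≤ wallConstLoc(d,L)·(a_B·‖∇F‖_{ℓ¹} + ‖∇F‖²_{ℓ²} + a_B³·#Y)(U_B on N_{2L}(B(Y)))
  + L^{d−4}·(a_A·Σ_{p∈Y×planes}‖(d_{U_A}X)(p)‖ + (7/2)·Σ_{p∈Y×planes} bondSq X p)`. [folklore] -/
theorem abs_twoLevel_windowAction_sub_le (L : ℕ) (hL : 1 ≤ L) {UB UA : Site d → Fin d → (Matrix n n ℂ)ˣ}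
    (hUB : IsUnitaryCfg UB) (hUA : IsUnitaryCfg UA) {aB aA : ℝ} (haB : 0 ≤ aB)
    (hsmall : 512 * (d + 1) * (d + 4) * (L : ℝ) ^ 2 * aB ≤ 1) (hUBa : SmallField UB aB)
    {X : Site d → Fin d → Matrix n n ℂ} (hX : IsSkewDir X) {u : Site d → (Matrix n n ℂ)ˣ}
    (hrep : gaugeAct u (rescale L (bavg L UB)) = vary UA X 1) (Y : Finset (Site d))
    (haA : ∀ p ∈ Y ×ˢ (Finset.univ : Finset (T4AveragingDeficitWall.Plane d)),
      ‖((fhol UA p : (Matrix n n ℂ)ˣ) : Matrix n n ℂ) - 1‖ ≤ aA) :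
    |(L : ℝ) ^ ((d : ℤ) - 4) * fineAction UA (Y ×ˢ Finset.univ) - fineAction UB (blockSites L Y ×ˢ Finset.univ)|
      ≤ wallConstLoc d L * (aB * gradFluxL1 UB (nbhd (2 * L) (blockSites L Y))
            + gradFluxSq UB (nbhd (2 * L) (blockSites L Y)) + aB ^ 3 * Y.card)
        + (L : ℝ) ^ ((d : ℤ) - 4) * (aA * ∑ p ∈ Y ×ˢ Finset.univ, ‖curl UA X p‖
            + 7 / 2 * ∑ p ∈ Y ×ˢ Finset.univ, bondSq X p) := by
  rw [windowAction_sub_eq L hrep Y]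
  have hD := abs_deficit_blockWindow_le L hL hUB haB hsmall hUBa Y
  have hA := abs_fineAction_vary_sub_le hUA hX (Y ×ˢ Finset.univ) haA
  have hw : 0 ≤ (L : ℝ) ^ ((d : ℤ) - 4) := zpow_nonneg (Nat.cast_nonneg L) _
  have hA' : |(L : ℝ) ^ ((d : ℤ) - 4)
      * (fineAction UA (Y ×ˢ Finset.univ) - fineAction (vary UA X 1) (Y ×ˢ Finset.univ))|
      ≤ (L : ℝ) ^ ((d : ℤ) - 4) * (aA * ∑ p ∈ Y ×ˢ Finset.univ, ‖curl UA X p‖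
            + 7 / 2 * ∑ p ∈ Y ×ˢ Finset.univ, bondSq X p) := by
    rw [abs_mul, abs_of_nonneg hw, abs_sub_comm]
    exact mul_le_mul_of_nonneg_left hA hw
  exact (abs_add_le _ _).trans (add_le_add hD hA')

/-- The same with the coarse plaquette radius read from the tree's class predicate `SmallField U_A a_A`. [folklore] -/
theorem abs_twoLevel_windowAction_sub_le_of_smallField (L : ℕ) (hL : 1 ≤ L)
    {UB UA : Site d → Fin d → (Matrix n n ℂ)ˣ} (hUB : IsUnitaryCfg UB) (hUA : IsUnitaryCfg UA) {aB aA : ℝ}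
    (haB : 0 ≤ aB) (hsmall : 512 * (d + 1) * (d + 4) * (L : ℝ) ^ 2 * aB ≤ 1) (hUBa : SmallField UB aB)
    (hUAa : SmallField UA aA) {X : Site d → Fin d → Matrix n n ℂ} (hX : IsSkewDir X) {u : Site d → (Matrix n n ℂ)ˣ}
    (hrep : gaugeAct u (rescale L (bavg L UB)) = vary UA X 1) (Y : Finset (Site d)) :
    |(L : ℝ) ^ ((d : ℤ) - 4) * fineAction UA (Y ×ˢ Finset.univ) - fineAction UB (blockSites L Y ×ˢ Finset.univ)|
      ≤ wallConstLoc d L * (aB * gradFluxL1 UB (nbhd (2 * L) (blockSites L Y))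
            + gradFluxSq UB (nbhd (2 * L) (blockSites L Y)) + aB ^ 3 * Y.card)
        + (L : ℝ) ^ ((d : ℤ) - 4) * (aA * ∑ p ∈ Y ×ˢ Finset.univ, ‖curl UA X p‖
            + 7 / 2 * ∑ p ∈ Y ×ˢ Finset.univ, bondSq X p) :=
  abs_twoLevel_windowAction_sub_le L hL hUB hUA haB hsmall hUBa hX hrep Y
    (fhol_sub_one_le_of_smallField hUAa _)

end

end Summit.QuantumFields.BalabanUV.T4Continuum.NE3LocalReadoutsPair
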